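import Literature.AlgebraicGeometry.Morphisms.FormalModuleTrickyPrep
import Literature.AlgebraicGeometry.Morphisms.FormalModuleCompletionAdditive
import Literature.AlgebraicGeometry.Modules.IsZeroOfAffineCover
import Literature.AlgebraicGeometry.Modules.IsoOfSectionsOnBasis
import Literature.AlgebraicGeometry.Modules.IdealSheafNoetherian
import Literature.RingTheory.AdicTopology.AdicTowerTricky
import HarnessLib

/-!
# The tricky lemma of Grothendieck's existence theorem (Step C and assembly)

The Stacks Project, Tag 088A (Cohomology of Schemes, Lemma 30.27.3), in a single-`e` fibre-product
form adapted to the tree's quotient model of coherent formal modules along `V(a)` on a scheme `X`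
proper over a noetherian ring `A` complete for the `a`-adic topology (`a' = a|_X`,
`M^ = (M/aⁿ⁺¹M)_n`):

**Step C** (`exists_coh_iso_of_levelwise_epi`). Let `𝓕` be a formal tower of coherent modules,
`H₁` coherent and `α̃ : 𝓕 ↠ H₁^` a LEVELWISE EPIMORPHISM whose levelwise kernels are killed by
`𝒥ᵈ` for an ideal sheaf `𝒥`. Assume that for all `e ≥ d` the tower `(𝓕_n/𝒥ᵉ𝓕_n)_n` is
algebraizable. Then `𝓕` is algebraizable: for `e ≫ 0`, writing `(𝓕_n/𝒥ᵉ𝓕_n) ≅ G^` and letting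
`g : G → H₁/𝒥ᵉH₁` be the algebraization (full faithfulness, GW II Cor. 24.100) of
`G^ ≅ 𝓕/𝒥ᵉ ↠ H₁^/𝒥ᵉ ≅ (H₁/𝒥ᵉH₁)^`, one has **`𝓕 ≅ F^` for the fibre product
`F = G ×_{H₁/𝒥ᵉH₁} H₁ = ker (G ⊞ H₁ → H₁/𝒥ᵉH₁)`**. The comparison map is built from
`𝓕 → (G ⊞ H₁)^`, which lands levelwise in the kernels of `(G ⊞ H₁)^ ↠ (H₁/𝒥ᵉ)^`, descends along
the shift principle (`FormalModuleShift`) and is composed with the completion-vs-kernel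
isomorphism (`FormalModuleCompletionKernel`, GW II Cor. 24.90); it is surjective on affine
sections by a diagram chase and injective for `e`, shift `≫ 0` by the double Artin–Rees bound of
`RingTheory/AdicTopology/AdicTowerTricky` applied to the finite `𝒪(V)^`-modules `lim 𝓕_n(V)` over
a finite affine cover.

**Assembly** (`exists_coh_iso_of_torsion_kernel_cokernel`, the tricky lemma): if
`α : 𝓕 → H^` has levelwise kernels AND cokernels killed by `𝒥ᵈ`, `𝓕`, `H` are killed by an ideal
sheaf `𝒦`, and every formal tower of coherent modules killed by `𝒦 + 𝒥ᵉ` (`e ≥ d`) is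
algebraizable, then `𝓕` is algebraizable — Steps A and B of `FormalModuleTrickyPrep` reduce to
Step C.

Everything is proved; no named facts.

## References

* The Stacks Project, Tag 088A (Lemma 30.27.3), Tags 087W, 087X, 00IN. [StacksProject]
* U. Görtz, T. Wedhorn, *Algebraic Geometry II: Cohomology of Schemes*, Springer Spektrum (2023),
  Cor. 24.90, Prop. 24.91, Rem. 24.92, Cor. 24.100 (pp. 565–569). [GortzWedhorn2023]
-/

noncomputable section

-- `TopCat.Presheaf`/`Scheme.Modules` are not reducible (as in Mathlib's `AlgebraicGeometry/Modules`).
set_option backward.isDefEq.respectTransparency false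

open CategoryTheory AlgebraicGeometry Limits TopologicalSpace Opposite
open Literature.AlgebraicGeometry.Modules Literature.RingTheory.AdicTopology

universe u

namespace Literature.AlgebraicGeometry.Morphisms

/-! ### Sections bookkeeping -/

section Sections

variable {X : Scheme.{u}} (a : Γ(X, ⊤)) {M N P : X.Modules} (V : X.Opens)

/-- `(φ + ψ)(x) = φ(x) + ψ(x)` on sections. [folklore] -/
theorem add_app_apply (φ ψ : M ⟶ N) (x : Γ(M, V)) : (φ + ψ).app V x = φ.app V x + ψ.app V x := rfl

/-- `(-φ)(x) = -φ(x)` on sections. [folklore] -/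
theorem neg_app_apply (φ : M ⟶ N) (x : Γ(M, V)) : (-φ).app V x = -φ.app V x := rfl

/-- `0(x) = 0` on sections. [folklore] -/
theorem zero_app_apply (x : Γ(M, V)) : (0 : M ⟶ N).app V x = 0 := rfl

/-- `𝟙(x) = x` on sections. [folklore] -/
theorem id_app_apply (x : Γ(M, V)) : (𝟙 M : M ⟶ M).app V x = x := rfl

/-- `(φ ≫ ψ)^_n (x) = ψ^_n (φ^_n x)` on sections. [folklore] -/
theorem cmplMapApp_comp_app_apply (φ : M ⟶ N) (ψ : N ⟶ P) (n : ℕ) (x : Γ(cmplObj a M n, V)) :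
    (cmplMapApp a (φ ≫ ψ) n).app V x = (cmplMapApp a ψ n).app V ((cmplMapApp a φ n).app V x) := by
  rw [cmplMapApp_comp]; rfl

/-- `fst^ (inl^ z) = z` on sections. [folklore] -/
theorem cmplMapApp_fst_inl_apply (n : ℕ) (z : Γ(cmplObj a M n, V)) :
    (cmplMapApp a (biprod.fst : M ⊞ N ⟶ M) n).app V ((cmplMapApp a (biprod.inl : M ⟶ M ⊞ N) n).app V z) = z := by
  rw [← cmplMapApp_comp_app_apply, biprod.inl_fst, cmplMapApp_id]; rfl

/-- `snd^ (inr^ z) = z` on sections. [folklore] -/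
theorem cmplMapApp_snd_inr_apply (n : ℕ) (z : Γ(cmplObj a N n, V)) :
    (cmplMapApp a (biprod.snd : M ⊞ N ⟶ N) n).app V ((cmplMapApp a (biprod.inr : N ⟶ M ⊞ N) n).app V z) = z := by
  rw [← cmplMapApp_comp_app_apply, biprod.inr_snd, cmplMapApp_id]; rfl

/-- `fst^ (inr^ z) = 0` on sections. [folklore] -/
theorem cmplMapApp_fst_inr_apply (n : ℕ) (z : Γ(cmplObj a N n, V)) :
    (cmplMapApp a (biprod.fst : M ⊞ N ⟶ M) n).app V ((cmplMapApp a (biprod.inr : N ⟶ M ⊞ N) n).app V z) = 0 := by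
  rw [← cmplMapApp_comp_app_apply, biprod.inr_fst, cmplMapApp_zero]; rfl

/-- `snd^ (inl^ z) = 0` on sections. [folklore] -/
theorem cmplMapApp_snd_inl_apply (n : ℕ) (z : Γ(cmplObj a M n, V)) :
    (cmplMapApp a (biprod.snd : M ⊞ N ⟶ N) n).app V ((cmplMapApp a (biprod.inl : M ⟶ M ⊞ N) n).app V z) = 0 := by
  rw [← cmplMapApp_comp_app_apply, biprod.inl_snd, cmplMapApp_zero]; rfl

/-- The negative of an epimorphism is an epimorphism. [folklore] -/
theorem epi_neg (φ : M ⟶ N) [Epi φ] : Epi (-φ) :=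
  ⟨fun g h w => (cancel_epi φ).mp (neg_injective (by
    rwa [← Preadditive.neg_comp, ← Preadditive.neg_comp]))⟩

end Sections

/-! ### The local Artin–Rees bound -/

section Local

variable {X : Scheme.{u}} {a : Γ(X, ⊤)} [IsLocallyNoetherian X]
  {𝓕 : ℕᵒᵖ ⥤ X.Modules} (h𝓕 : IsFormalTower a 𝓕) (h𝓕c : ∀ n, Coh (𝓕.obj ⟨n⟩))
  {H₁ : X.Modules} (hH₁ : Coh H₁) (αt : 𝓕 ⟶ cmplTower a H₁) (hαt : ∀ n, Epi (αt.app ⟨n⟩))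
  {J : X.IdealSheafData} {d : ℕ} (hker : ∀ n, IsKilledBy (J ^ d) (kernel (αt.app ⟨n⟩)))
  {V : X.Opens} (hV : IsAffineOpen V)

include h𝓕 h𝓕c hH₁ hαt hker in
/-- **The local bound** (`AdicTowerTricky.exists_forall_mem_pow_smul_of_mem_of_apply_eq_zero` for
the towers of `V`-sections, `V` affine): there is `e₀` such that for `e ≥ e₀` there is `c₀` such that
for `c ≥ c₀` and all `n`, a section `x ∈ 𝒥ᵉ(V)·𝓕_{c+n}(V)` with `α̃(x) = 0` is `aⁿ⁺¹ · x'`.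
[cite: StacksProject, Tag 088A] [cite: StacksProject, Tag 00IN] -/
theorem exists_local_trickyBound :
    ∃ e₀ : ℕ, ∀ e, e₀ ≤ e → ∃ c₀ : ℕ, ∀ c, c₀ ≤ c → ∀ (n : ℕ) (x : Γ(𝓕.obj ⟨c + n⟩, V)),
      x ∈ (J ^ e).ideal ⟨V, hV⟩ • (⊤ : Submodule Γ(X, V) Γ(𝓕.obj ⟨c + n⟩, V)) →
      (αt.app ⟨c + n⟩).app V x = 0 →
        ∃ x' : Γ(𝓕.obj ⟨c + n⟩, V), x = resTop X V a ^ (n + 1) • x' := by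
  letI := fun n => h𝓕.levelQuotModule (V := V) n
  haveI : IsNoetherianRing Γ(X, V) := IsLocallyNoetherian.component_noetherian ⟨V, hV⟩
  haveI : Module.Finite Γ(X, V) Γ(𝓕.obj ⟨0⟩, V) := (h𝓕c 0).ft hV
  have hH₁c : ∀ n, Coh ((cmplTower a H₁).obj ⟨n⟩) := coh_cmplTower a hH₁
  have hI : (Ideal.span {resTop X V a}).FG := ⟨{resTop X V a}, by rw [Finset.coe_singleton]⟩
  have hs : ∀ n, Function.Surjective (appLinear (towerπ 𝓕 n) V) := fun n y => by
    obtain ⟨x, hx⟩ := h𝓕.app_towerπ_surjective V h𝓕c hV n y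
    exact ⟨x, hx⟩
  have hkers : ∀ n, LinearMap.ker (appLinear (towerπ 𝓕 n) V) ≤
      Ideal.span {resTop X V a} ^ (n + 1) • ⊤ := fun n =>
    (h𝓕.ker_appLinear_towerπ V h𝓕c hV n).le
  have hsurj : ∀ n, Function.Surjective (appLinear (αt.app ⟨n⟩) V) :=
    app_surjective_of_levelwise_epi αt V h𝓕c hH₁c hαt hV
  have hkert : ∀ n, LinearMap.ker (appLinear (towerπ (cmplTower a H₁) n) V) ≤
      Ideal.span {resTop X V a} ^ (n + 1) • ⊤ :=
    fun n => ((isFormalTower_cmplTower a H₁).ker_appLinear_towerπ V hH₁c hV n).le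
  have hK : ∀ n, ∀ k ∈ J.ideal ⟨V, hV⟩ ^ d, ∀ x : Γ(𝓕.obj ⟨n⟩, V),
      appLinear (αt.app ⟨n⟩) V x = 0 → k • x = 0 := by
    intro n k hk x hx
    obtain ⟨y, rfl⟩ := exists_kernel_ι_app_eq (αt.app ⟨n⟩) V x hx
    rw [← Scheme.Modules.Hom.app_smul, hker n ⟨V, hV⟩ k hk y, map_zero]
  obtain ⟨e₀, he₀⟩ := exists_forall_mem_pow_smul_of_mem_of_apply_eq_zero (Ideal.span {resTop X V a})
    (fun n => appLinear (towerπ 𝓕 n) V) (fun n => appLinear (towerπ (cmplTower a H₁) n) V)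
    (fun n => appLinear (αt.app ⟨n⟩) V) (appLinear_towerπ_comp αt V) hI hs hkers hsurj hkert hK
  refine ⟨e₀, fun e he => ?_⟩
  obtain ⟨c₀, hc₀⟩ := he₀ e he
  refine ⟨c₀, fun c hc n x hxJ hx0 => ?_⟩
  have h := hc₀ c hc n x hxJ hx0
  rw [Ideal.span_singleton_pow, Submodule.ideal_span_singleton_smul,
    Submodule.mem_smul_pointwise_iff_exists] at h
  obtain ⟨x', -, rfl⟩ := h
  exact ⟨x', rfl⟩

end Local

/-! ### Step C: the fibre-product construction -/

section Core

variable {A : Type u} [CommRing A] {X : Scheme.{u}} (f : X ⟶ Spec (.of A)) (a : A)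
  {𝓕 : ℕᵒᵖ ⥤ X.Modules} (h𝓕 : IsFormalTower (algebraMapΓ f a) 𝓕)
  {H₁ : X.Modules} (αt : 𝓕 ⟶ cmplTower (algebraMapΓ f a) H₁)
  {G Q : X.Modules} (p : 𝓕 ⟶ cmplTower (algebraMapΓ f a) G) (g : G ⟶ Q) (η : H₁ ⟶ Q)
  (hcomm : p ≫ cmplMap (algebraMapΓ f a) g = αt ≫ cmplMap (algebraMapΓ f a) η)

/-- The map `W = (g, -η) : G ⊞ H₁ → Q` whose kernel is the fibre product `G ×_Q H₁`. [cite: StacksProject, Tag 088A] -/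
def trickyW : G ⊞ H₁ ⟶ Q := biprod.desc g (-η)

/-- `W` is an epimorphism if `η` is. [folklore] -/
theorem epi_trickyW [Epi η] : Epi (trickyW g η) := by
  haveI := epi_neg η
  exact epi_of_epi_fac (biprod.inr_desc g (-η))

/-- The map `Ψ = (p, α̃) : 𝓕 → (G ⊞ H₁)^`. [cite: StacksProject, Tag 088A] -/
def trickyΨ : 𝓕 ⟶ cmplTower (algebraMapΓ f a) (G ⊞ H₁) :=
  p ≫ cmplMap (algebraMapΓ f a) biprod.inl + αt ≫ cmplMap (algebraMapΓ f a) biprod.inr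

include hcomm in
/-- `Ψ ≫ W^ = p ≫ g^ - α̃ ≫ η^ = 0`. [folklore] -/
theorem trickyΨ_comp_cmplMap_trickyW : trickyΨ f a αt p ≫ cmplMap (algebraMapΓ f a) (trickyW g η) = 0 := by
  rw [trickyΨ, trickyW, Preadditive.add_comp, Category.assoc, Category.assoc, ← cmplMap_comp,
    ← cmplMap_comp, biprod.inl_desc, biprod.inr_desc, cmplMap_neg, Preadditive.comp_neg, hcomm,
    add_neg_cancel]

/-- `Ψ` on sections. [folklore] -/
theorem trickyΨ_app_apply (m : ℕ) (V : X.Opens) (x : Γ(𝓕.obj ⟨m⟩, V)) :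
    ((trickyΨ f a αt p).app ⟨m⟩).app V x =
      (cmplMapApp (algebraMapΓ f a) (biprod.inl : G ⟶ G ⊞ H₁) m).app V ((p.app ⟨m⟩).app V x) +
        (cmplMapApp (algebraMapΓ f a) (biprod.inr : H₁ ⟶ G ⊞ H₁) m).app V ((αt.app ⟨m⟩).app V x) := by
  rw [trickyΨ, NatTrans.app_add, add_app_apply, NatTrans.comp_app, NatTrans.comp_app, cmplMap_app,
    cmplMap_app]
  rfl

/-- `fst^ ∘ Ψ = p` on sections. [folklore] -/
theorem fst_trickyΨ_app_apply (m : ℕ) (V : X.Opens) (x : Γ(𝓕.obj ⟨m⟩, V)) :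
    (cmplMapApp (algebraMapΓ f a) (biprod.fst : G ⊞ H₁ ⟶ G) m).app V
      (((trickyΨ f a αt p).app ⟨m⟩).app V x) = (p.app ⟨m⟩).app V x := by
  rw [trickyΨ_app_apply, map_add, cmplMapApp_fst_inl_apply, cmplMapApp_fst_inr_apply, add_zero]

/-- `snd^ ∘ Ψ = α̃` on sections. [folklore] -/
theorem snd_trickyΨ_app_apply (m : ℕ) (V : X.Opens) (x : Γ(𝓕.obj ⟨m⟩, V)) :
    (cmplMapApp (algebraMapΓ f a) (biprod.snd : G ⊞ H₁ ⟶ H₁) m).app V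
      (((trickyΨ f a αt p).app ⟨m⟩).app V x) = (αt.app ⟨m⟩).app V x := by
  rw [trickyΨ_app_apply, map_add, cmplMapApp_snd_inl_apply, cmplMapApp_snd_inr_apply, zero_add]

/-- `W^` on sections: `W^(z) = g^(fst^ z) - η^(snd^ z)`. [folklore] -/
theorem cmplMapApp_trickyW_app_apply (m : ℕ) (V : X.Opens)
    (z : Γ(cmplObj (algebraMapΓ f a) (G ⊞ H₁) m, V)) :
    (cmplMapApp (algebraMapΓ f a) (trickyW g η) m).app V z =
      (cmplMapApp (algebraMapΓ f a) g m).app V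
          ((cmplMapApp (algebraMapΓ f a) (biprod.fst : G ⊞ H₁ ⟶ G) m).app V z) -
        (cmplMapApp (algebraMapΓ f a) η m).app V
          ((cmplMapApp (algebraMapΓ f a) (biprod.snd : G ⊞ H₁ ⟶ H₁) m).app V z) := by
  have h1 : ∀ y, (cmplMapApp (algebraMapΓ f a) (trickyW g η) m).app V
      ((cmplMapApp (algebraMapΓ f a) (biprod.inl : G ⟶ G ⊞ H₁) m).app V y) =
        (cmplMapApp (algebraMapΓ f a) g m).app V y := fun y => by
    rw [← cmplMapApp_comp_app_apply, trickyW, biprod.inl_desc]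
  have h2 : ∀ y, (cmplMapApp (algebraMapΓ f a) (trickyW g η) m).app V
      ((cmplMapApp (algebraMapΓ f a) (biprod.inr : H₁ ⟶ G ⊞ H₁) m).app V y) =
        -((cmplMapApp (algebraMapΓ f a) η m).app V y) := fun y => by
    rw [← cmplMapApp_comp_app_apply, trickyW, biprod.inr_desc, cmplMapApp_neg, neg_app_apply]
  conv_lhs => rw [← cmplMapApp_biprod_decomp (algebraMapΓ f a) G H₁ m V z]
  rw [map_add, h1, h2, sub_eq_add_neg]

include hcomm in
/-- `(p ≫ g^)(x) = (α̃ ≫ η^)(x)` on sections. [folklore] -/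
theorem hcomm_app_apply (m : ℕ) (V : X.Opens) (x : Γ(𝓕.obj ⟨m⟩, V)) :
    (cmplMapApp (algebraMapΓ f a) g m).app V ((p.app ⟨m⟩).app V x) =
      (cmplMapApp (algebraMapΓ f a) η m).app V ((αt.app ⟨m⟩).app V x) := by
  have h := congrArg (fun θ : 𝓕 ⟶ cmplTower (algebraMapΓ f a) Q => (θ.app ⟨m⟩).app V x) hcomm
  simp only [NatTrans.comp_app, cmplMap_app] at h
  exact h

variable [IsLocallyNoetherian X] (h𝓕c : ∀ n, Coh (𝓕.obj ⟨n⟩)) (hH₁ : Coh H₁) (hG : Coh G) (hQ : Coh Q)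
  (hp : ∀ n, Epi (p.app ⟨n⟩)) (hαt : ∀ n, Epi (αt.app ⟨n⟩)) {V : X.Opens} (hV : IsAffineOpen V)
  {K : Ideal Γ(X, V)}
  (hGK : ∀ m, ∀ k ∈ K, ∀ z : Γ((cmplTower (algebraMapΓ f a) G).obj ⟨m⟩, V), k • z = 0)
  (hηK : ∀ m (z : Γ((cmplTower (algebraMapΓ f a) H₁).obj ⟨m⟩, V)),
    (cmplMapApp (algebraMapΓ f a) η m).app V z = 0 →
      z ∈ K • (⊤ : Submodule Γ(X, V) Γ((cmplTower (algebraMapΓ f a) H₁).obj ⟨m⟩, V)))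

include hcomm h𝓕c hH₁ hG hp hαt hV hGK hηK in
/-- **`λ_m : 𝓕_m(V) → ker(W^_m)(V)` is surjective** on an affine open `V` (diagram chase: `𝒥ᵉ(V)`
kills `G^_m(V)`, and the kernel of `η^_m` on `V`-sections is `𝒥ᵉ(V)·H₁^_m(V)`). [cite: StacksProject, Tag 088A] -/
theorem liftToKerTower_trickyΨ_app_surjective [Epi η] (m : ℕ) :
    Function.Surjective ((liftToKerTower f a (trickyΨ f a αt p) (trickyW g η)
      (trickyΨ_comp_cmplMap_trickyW f a αt p g η hcomm) m).app V) := by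
  intro z
  have hGc : ∀ n, Coh ((cmplTower (algebraMapΓ f a) G).obj ⟨n⟩) := coh_cmplTower _ hG
  have hH₁c : ∀ n, Coh ((cmplTower (algebraMapΓ f a) H₁).obj ⟨n⟩) := coh_cmplTower _ hH₁
  set z' := (kernel.ι ((cmplMap (algebraMapΓ f a) (trickyW g η)).app ⟨m⟩)).app V z with hz'
  set z₁ : Γ((cmplTower (algebraMapΓ f a) G).obj ⟨m⟩, V) :=
    (cmplMapApp (algebraMapΓ f a) (biprod.fst : G ⊞ H₁ ⟶ G) m).app V z' with hz₁
  set z₂ : Γ((cmplTower (algebraMapΓ f a) H₁).obj ⟨m⟩, V) :=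
    (cmplMapApp (algebraMapΓ f a) (biprod.snd : G ⊞ H₁ ⟶ H₁) m).app V z' with hz₂
  have hWz : (cmplMapApp (algebraMapΓ f a) g m).app V z₁ = (cmplMapApp (algebraMapΓ f a) η m).app V z₂ := by
    have h0 : (cmplMapApp (algebraMapΓ f a) (trickyW g η) m).app V z' = 0 := app_kernel_ι_app _ V z
    rw [cmplMapApp_trickyW_app_apply, sub_eq_zero] at h0
    exact h0
  -- `z₁ = p x`
  obtain ⟨x, hx⟩ := app_surjective_of_levelwise_epi p V h𝓕c hGc hp hV m z₁
  change (p.app ⟨m⟩).app V x = z₁ at hx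
  -- `η^ (z₂ - α̃ x) = 0`, so `z₂ - α̃ x ∈ K • ⊤ = α̃ (K • ⊤)`
  have hη0 : (cmplMapApp (algebraMapΓ f a) η m).app V (z₂ - (αt.app ⟨m⟩).app V x) = 0 := by
    rw [map_sub, ← hcomm_app_apply f a αt p g η hcomm, hx, hWz, sub_self]
  have hmem := hηK m _ hη0
  have hlift : ∀ w ∈ K • (⊤ : Submodule Γ(X, V) Γ((cmplTower (algebraMapΓ f a) H₁).obj ⟨m⟩, V)),
      ∃ y : Γ(𝓕.obj ⟨m⟩, V), (p.app ⟨m⟩).app V y = 0 ∧ (αt.app ⟨m⟩).app V y = w := by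
    intro w hw
    refine Submodule.smul_induction_on hw (fun k hk h _ => ?_) ?_
    · obtain ⟨xh, hxh⟩ := app_surjective_of_levelwise_epi αt V h𝓕c hH₁c hαt hV m h
      refine ⟨k • xh, ?_, ?_⟩
      · rw [Scheme.Modules.Hom.app_smul]; exact hGK m k hk _
      · rw [Scheme.Modules.Hom.app_smul]; exact congrArg (k • ·) hxh
    · rintro w₁ w₂ ⟨y₁, hy₁, rfl⟩ ⟨y₂, hy₂, rfl⟩
      exact ⟨y₁ + y₂, by rw [map_add, hy₁, hy₂, add_zero], map_add _ _ _⟩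
  obtain ⟨y, hy0, hyα⟩ := hlift _ hmem
  -- `x' = x + y` maps to `z'` under `Ψ`
  have hpx : (p.app ⟨m⟩).app V (x + y) = z₁ := by rw [map_add, hx, hy0, add_zero]
  have hαx : (αt.app ⟨m⟩).app V (x + y) = z₂ := by rw [map_add, hyα, add_sub_cancel]
  refine ⟨x + y, kernel_ι_app_injective _ V ?_⟩
  rw [← comp_app_apply, liftToKerTower_ι, trickyΨ_app_apply, hpx, hαx, ← hz']
  exact cmplMapApp_biprod_decomp (algebraMapΓ f a) G H₁ m V z'

end Core

/-! ### Step C: the theorem -/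

section StepC

variable {A : Type u} [CommRing A] [IsNoetherianRing A] {X : Scheme.{u}} (f : X ⟶ Spec (.of A))
  [IsProper f] (a : A) [IsAdicComplete (Ideal.span {a}) A] [IsLocallyNoetherian X] [CompactSpace X]

/-- **Step C of the tricky lemma.** Let `𝓕` be a formal tower of coherent modules, `H₁` coherent,
`α̃ : 𝓕 ↠ H₁^` a levelwise epimorphism with levelwise kernels killed by `𝒥ᵈ`, and assume the
towers `(𝓕_n/𝒥ᵉ𝓕_n)_n`, `e ≥ d`, are algebraizable. Then `𝓕 ≅ F^` for a coherent `F` (namely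
`F = G ×_{H₁/𝒥ᵉH₁} H₁` for `e ≫ 0`). [cite: StacksProject, Tag 088A] [cite: GortzWedhorn2023, Cor. 24.90 and Cor. 24.100 (pp. 565–569)] -/
theorem exists_coh_iso_of_levelwise_epi {𝓕 : ℕᵒᵖ ⥤ X.Modules}
    (h𝓕 : IsFormalTower (algebraMapΓ f a) 𝓕) (h𝓕c : ∀ n, Coh (𝓕.obj ⟨n⟩)) {H₁ : X.Modules}
    (hH₁ : Coh H₁) (αt : 𝓕 ⟶ cmplTower (algebraMapΓ f a) H₁) (hαt : ∀ n, Epi (αt.app ⟨n⟩))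
    {J : X.IdealSheafData} {d : ℕ} (hker : ∀ n, IsKilledBy (J ^ d) (kernel (αt.app ⟨n⟩)))
    (IH : ∀ e, d ≤ e → ∃ G : X.Modules, Coh G ∧
      Nonempty (𝓕 ⋙ idealQuotFunctor (J ^ e) ≅ cmplTower (algebraMapΓ f a) G)) :
    ∃ F : X.Modules, Coh F ∧ Nonempty (𝓕 ≅ cmplTower (algebraMapΓ f a) F) := by
  classical
  -- a finite affine cover and the exponent `e`
  obtain ⟨T, hT⟩ := exists_finite_affineOpens_iSup_eq_top (X := X)
  choose eV heV using fun V : T =>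
    exists_local_trickyBound h𝓕 h𝓕c hH₁ αt hαt hker (V : X.affineOpens).2
  set e : ℕ := max d (Finset.univ.sup eV) with he
  have hde : d ≤ e := le_max_left _ _
  have heVe : ∀ V : T, eV V ≤ e := fun V =>
    (Finset.le_sup (f := eV) (Finset.mem_univ V)).trans (le_max_right _ _)
  choose cV hcV using fun V : T => heV V e (heVe V)
  -- the algebraization `G` of `𝓕/𝒥ᵉ`
  obtain ⟨G, hG, ⟨ε⟩⟩ := IH e hde
  set Je : X.IdealSheafData := J ^ e with hJe
  -- `q : 𝓕 → 𝓕/𝒥ᵉ`, `p = q ≫ ε : 𝓕 ↠ G^`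
  let q : 𝓕 ⟶ 𝓕 ⋙ idealQuotFunctor Je :=
    { app := fun k => idealQuotπ (𝓕.obj k) Je
      naturality := fun k k' h => (idealQuotπ_idealQuotMap Je (𝓕.map h)).symm }
  let p : 𝓕 ⟶ cmplTower (algebraMapΓ f a) G := q ≫ ε.hom
  have hp : ∀ n, Epi (p.app ⟨n⟩) := fun n => by
    change Epi (idealQuotπ (𝓕.obj ⟨n⟩) Je ≫ ε.hom.app ⟨n⟩)
    exact epi_comp _ _
  -- `Q = H₁/𝒥ᵉH₁`, `η`, and `g : G → Q` algebraizing `G^ ≅ 𝓕/𝒥ᵉ → H₁^/𝒥ᵉ ≅ Q^`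
  set Q : X.Modules := idealQuot H₁ Je with hQdef
  have hQ : Coh Q := coh_idealQuot Je hH₁
  let η : H₁ ⟶ Q := idealQuotπ H₁ Je
  let w : cmplTower (algebraMapΓ f a) G ⟶ cmplTower (algebraMapΓ f a) Q :=
    ε.inv ≫ Functor.whiskerRight αt (idealQuotFunctor Je) ≫ (idealQuotCmplTowerIso (algebraMapΓ f a) Je H₁).hom
  obtain ⟨g, hg, -⟩ := existsUnique_cmplMap_coh f a hG hQ w
  have hcomm : p ≫ cmplMap (algebraMapΓ f a) g = αt ≫ cmplMap (algebraMapΓ f a) η := by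
    rw [hg]
    refine NatTrans.ext (funext fun k => ?_)
    obtain ⟨n⟩ := k
    change (idealQuotπ (𝓕.obj ⟨n⟩) Je ≫ ε.hom.app ⟨n⟩) ≫ ε.inv.app ⟨n⟩ ≫
      idealQuotMap Je (αt.app ⟨n⟩) ≫ (idealQuotCmplObjIso (algebraMapΓ f a) Je H₁ n).hom =
        αt.app ⟨n⟩ ≫ cmplMapApp (algebraMapΓ f a) (idealQuotπ H₁ Je) n
    rw [Category.assoc, Iso.hom_inv_id_app_assoc, idealQuotπ_idealQuotMap_assoc]
    exact congrArg (αt.app ⟨n⟩ ≫ ·) (idealQuotπ_cmplObj_comp (algebraMapΓ f a) Je H₁ n)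
  -- the fibre product `F = ker W`, `W = (g, -η) : G ⊞ H₁ ↠ Q`
  haveI : Epi η := by change Epi (idealQuotπ H₁ Je); infer_instance
  haveI : Epi (trickyW g η) := epi_trickyW g η
  have hGH : Coh (G ⊞ H₁) := coh_biprod hG hH₁
  obtain ⟨c₁, hc₁⟩ := exists_forall_iso_kerShift_cmplMap (a := algebraMapΓ f a) (w := trickyW g η) hGH hQ
  set c : ℕ := max c₁ (Finset.univ.sup cV) with hc
  obtain ⟨hformal, θ₁, hθ₁⟩ := hc₁ c (le_max_left _ _)
  have hcVc : ∀ V : T, cV V ≤ c := fun V =>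
    (Finset.le_sup (f := cV) (Finset.mem_univ V)).trans (le_max_right _ _)
  -- the comparison map `θ' : 𝓕 → kerShift W^ c`
  have hΨ := trickyΨ_comp_cmplMap_trickyW f a αt p g η hcomm
  let θ' := trickyLift' f a h𝓕 (trickyΨ f a αt p) (trickyW g η) hΨ (c₁ := c)
  -- coherence bookkeeping
  have hGc : ∀ n, Coh ((cmplTower (algebraMapΓ f a) G).obj ⟨n⟩) := coh_cmplTower _ hG
  have hH₁c : ∀ n, Coh ((cmplTower (algebraMapΓ f a) H₁).obj ⟨n⟩) := coh_cmplTower _ hH₁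
  have hGHc : ∀ n, Coh ((cmplTower (algebraMapΓ f a) (G ⊞ H₁)).obj ⟨n⟩) := coh_cmplTower _ hGH
  have hQc : ∀ n, Coh ((cmplTower (algebraMapΓ f a) Q).obj ⟨n⟩) := coh_cmplTower _ hQ
  have hKc : ∀ n, Coh ((kerTower (cmplMap (algebraMapΓ f a) (trickyW g η))).obj ⟨n⟩) :=
    coh_kerTower hGHc hQc
  have hKSc : ∀ n, Coh ((kerShift (algebraMapΓ f a) (cmplMap (algebraMapΓ f a) (trickyW g η)) c).obj ⟨n⟩) :=
    fun n => coh_kerShift (u := cmplMap (algebraMapΓ f a) (trickyW g η)) (c := c) hGHc hQc n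
  -- `𝒥ᵉ(V)` kills `G^_m(V)` (as `G^_m ≅ 𝓕_m/𝒥ᵉ`), and the kernel of `η^_m` on affine sections
  have hGK : ∀ (V : X.affineOpens) m, ∀ k ∈ Je.ideal V, ∀ z : Γ(cmplObj (algebraMapΓ f a) G m, V),
      k • z = 0 := fun V m k hk z =>
    isKilledBy_of_iso (ε.app ⟨m⟩) (isKilledBy_idealQuot (𝓕.obj ⟨m⟩) Je) V k hk z
  have hηK : ∀ (V : X.affineOpens) m (z : Γ(cmplObj (algebraMapΓ f a) H₁ m, V)),
      (cmplMapApp (algebraMapΓ f a) η m).app V z = 0 →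
        z ∈ Je.ideal V • (⊤ : Submodule Γ(X, V) Γ(cmplObj (algebraMapΓ f a) H₁ m, V)) :=
    fun V m z hz => (cmplMapApp_idealQuotπ_app_eq_zero_iff (algebraMapΓ f a) Je H₁ m (hH₁c m).loc V.2 z).mp hz
  -- surjectivity of `λ_m` and of `θ'_n` on affine sections
  have hlam : ∀ (V : X.Opens), IsAffineOpen V → ∀ m, Function.Surjective
      ((liftToKerTower f a (trickyΨ f a αt p) (trickyW g η) hΨ m).app V) := fun V hV m =>
    liftToKerTower_trickyΨ_app_surjective f a αt p g η hcomm h𝓕c hH₁ hG hp hαt hV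
      (hGK ⟨V, hV⟩) (hηK ⟨V, hV⟩) m
  have hsurj : ∀ n (V : X.Opens), IsAffineOpen V → Function.Surjective ((θ'.app ⟨n⟩).app V) := by
    intro n V hV y
    have hπ : Function.Surjective ((kerShiftπ (algebraMapΓ f a) (cmplMap (algebraMapΓ f a) (trickyW g η)) c n).app V) :=
      app_surjective_of_epi _ (hKc _).loc (hKSc n).loc hV
    obtain ⟨k, rfl⟩ := hπ y
    obtain ⟨x, rfl⟩ := hlam V hV (c + n) k
    refine ⟨(𝓕.map (homOfLE (Nat.le_add_left n c)).op).app V x, ?_⟩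
    rw [← comp_app_apply, map_trickyLift'_app]
    rfl
  -- injectivity of `θ'_n` on the sections over the opens of the cover
  have hinj : ∀ n (V : T), Function.Injective ((θ'.app ⟨n⟩).app (V : X.affineOpens)) := by
    intro n V
    have hV : IsAffineOpen ((V : X.affineOpens) : X.Opens) := (V : X.affineOpens).2
    refine (injective_iff_map_eq_zero _).mpr fun z hz => ?_
    -- `z = 𝓕(c+n → n) x`
    haveI := h𝓕.epi_map (Nat.le_add_left n c)
    obtain ⟨x, rfl⟩ := app_surjective_of_epi (𝓕.map (homOfLE (Nat.le_add_left n c)).op)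
      (h𝓕c _).loc (h𝓕c _).loc hV z
    rw [← comp_app_apply, map_trickyLift'_app] at hz
    change (kerShiftπ (algebraMapΓ f a) (cmplMap (algebraMapΓ f a) (trickyW g η)) c n).app _
      ((liftToKerTower f a (trickyΨ f a αt p) (trickyW g η) hΨ (c + n)).app _ x) = 0 at hz
    -- `λ x = aⁿ⁺¹ λ x₁`
    obtain ⟨k', hk'⟩ := exists_app_eq_of_app_cokernel_π_eq_zero
      (globalScalar ((kerTower (cmplMap (algebraMapΓ f a) (trickyW g η))).obj ⟨c + n⟩)
        (algebraMapΓ f a ^ (n + 1))) (hKc _) (hKc _) hV _ hz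
    obtain ⟨x₁, rfl⟩ := hlam _ hV (c + n) k'
    rw [globalScalar_app_apply, map_pow, ← Scheme.Modules.Hom.app_smul] at hk'
    -- `y = x - aⁿ⁺¹ x₁ ∈ ker λ`, hence `p y = 0` and `α̃ y = 0`
    set y := x - resTop X ((V : X.affineOpens) : X.Opens) (algebraMapΓ f a) ^ (n + 1) • x₁ with hy
    have hlamy : (liftToKerTower f a (trickyΨ f a αt p) (trickyW g η) hΨ (c + n)).app _ y = 0 := by
      rw [hy, map_sub, hk', sub_self]
    have hΨy : ((trickyΨ f a αt p).app ⟨c + n⟩).app _ y = 0 := by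
      rw [← liftToKerTower_ι f a (trickyΨ f a αt p) (trickyW g η) hΨ (c + n), comp_app_apply, hlamy,
        map_zero]
    have hpy : (p.app ⟨c + n⟩).app _ y = 0 := by
      rw [← fst_trickyΨ_app_apply f a αt p, hΨy, map_zero]
    have hαy : (αt.app ⟨c + n⟩).app _ y = 0 := by
      rw [← snd_trickyΨ_app_apply f a αt p, hΨy, map_zero]
    -- `p y = 0 ⇒ q y = 0 ⇒ y ∈ 𝒥ᵉ(V) 𝓕_{c+n}(V)`
    have hqy : (idealQuotπ (𝓕.obj ⟨c + n⟩) Je).app _ y = 0 := by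
      have h1 : (ε.inv.app ⟨c + n⟩).app _ ((p.app ⟨c + n⟩).app _ y) = 0 := by rw [hpy, map_zero]
      rw [← comp_app_apply] at h1
      change ((q.app ⟨c + n⟩ ≫ ε.hom.app ⟨c + n⟩) ≫ ε.inv.app ⟨c + n⟩).app _ y = 0 at h1
      rwa [Category.assoc, Iso.hom_inv_id_app, Category.comp_id] at h1
    have hyJ := (idealQuotπ_app_eq_zero_iff Je (h𝓕c (c + n)).loc hV y).mp hqy
    -- the local bound
    obtain ⟨x', hx'⟩ := hcV V c (hcVc V) n y hyJ hαy
    -- conclude: `z = 𝓕(x) = 𝓕(y) + aⁿ⁺¹ 𝓕(x₁) = aⁿ⁺¹ (…) = 0`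
    have hx : x = y + resTop X ((V : X.affineOpens) : X.Opens) (algebraMapΓ f a) ^ (n + 1) • x₁ := by
      rw [hy, sub_add_cancel]
    rw [hx, hx', ← smul_add, Scheme.Modules.Hom.app_smul]
    exact h𝓕.pow_smul_app_eq_zero _ n _
  -- `θ'` is an isomorphism
  haveI : ∀ k : ℕᵒᵖ, IsIso (θ'.app k) := fun ⟨n⟩ => by
    haveI : Mono (θ'.app ⟨n⟩) :=
      mono_of_app_injective_of_cover _ (h𝓕c n).loc (hKSc n).loc
        (fun V : T => ((V : X.affineOpens) : X.Opens)) (fun V => (V : X.affineOpens).2) hT (hinj n)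
    haveI : Epi (θ'.app ⟨n⟩) := epi_of_surjective_app_of_isAffineOpen _ (hsurj n)
    exact isIso_of_mono_of_epi _
  haveI : IsIso θ' := NatIso.isIso_of_isIso_app _
  exact ⟨kernel (trickyW g η), Coh.kernel _ hGH hQ, ⟨asIso θ' ≪≫ θ₁.symm⟩⟩

end StepC

/-! ### The tricky lemma -/

section Assembly

variable {A : Type u} [CommRing A] [IsNoetherianRing A] {X : Scheme.{u}} (f : X ⟶ Spec (.of A))
  [IsProper f] (a : A) [IsAdicComplete (Ideal.span {a}) A] [IsLocallyNoetherian X] [CompactSpace X]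

/-- **The tricky lemma** (Stacks 088A, single-`e` fibre-product form). Let `𝓕` be a formal tower
of coherent modules and `H` a coherent module, both killed by an ideal sheaf `𝒦`, and
`α : 𝓕 → H^` a morphism of towers whose levelwise kernels and cokernels are killed by `𝒥ᵈ`.
If every formal tower of coherent modules killed by `𝒦` and by `𝒥ᵉ` (`e ≥ d`) is algebraizable,
then `𝓕` is algebraizable. (Step A: `coker α ≅ C^` gives `c : H ↠ C`; Step B: `α` lifts to a
levelwise epimorphism `α̃ : 𝓕 ↠ (ker c)^` with `𝒥ᵈ`-torsion kernels; Step C.)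
[cite: StacksProject, Tag 088A] [cite: GortzWedhorn2023, Cor. 24.90, Cor. 24.100 (pp. 565–569)] -/
theorem exists_coh_iso_of_torsion_kernel_cokernel {𝓕 : ℕᵒᵖ ⥤ X.Modules}
    (h𝓕 : IsFormalTower (algebraMapΓ f a) 𝓕) (h𝓕c : ∀ n, Coh (𝓕.obj ⟨n⟩)) {H : X.Modules}
    (hH : Coh H) (α : 𝓕 ⟶ cmplTower (algebraMapΓ f a) H) {K J : X.IdealSheafData} {d : ℕ}
    (h𝓕K : ∀ n, IsKilledBy K (𝓕.obj ⟨n⟩)) (hHK : IsKilledBy K H)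
    (hker : ∀ n, IsKilledBy (J ^ d) (kernel (α.app ⟨n⟩)))
    (hcoker : ∀ n, IsKilledBy (J ^ d) (cokernel (α.app ⟨n⟩)))
    (IH : ∀ e, d ≤ e → ∀ 𝓖 : ℕᵒᵖ ⥤ X.Modules, IsFormalTower (algebraMapΓ f a) 𝓖 →
      (∀ n, Coh (𝓖.obj ⟨n⟩)) → (∀ n, IsKilledBy K (𝓖.obj ⟨n⟩)) →
      (∀ n, IsKilledBy (J ^ e) (𝓖.obj ⟨n⟩)) →
        ∃ G : X.Modules, Coh G ∧ Nonempty (𝓖 ≅ cmplTower (algebraMapΓ f a) G)) :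
    ∃ F : X.Modules, Coh F ∧ Nonempty (𝓕 ≅ cmplTower (algebraMapΓ f a) F) := by
  -- the cokernel tower is algebraizable by the induction hypothesis
  have h𝓒 : IsFormalTower (algebraMapΓ f a) (cokerTower α) :=
    IsFormalTower.cokerTower h𝓕.epi (isFormalTower_cmplTower (algebraMapΓ f a) H)
  have h𝓒c : ∀ n, Coh ((cokerTower α).obj ⟨n⟩) := coh_cokerTower α h𝓕c (coh_cmplTower _ hH)
  have h𝓒K : ∀ n, IsKilledBy K ((cokerTower α).obj ⟨n⟩) := fun n =>
    IsKilledBy.of_epi (cokernel.π (α.app ⟨n⟩))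
      (IsKilledBy.of_epi (cmplπ (algebraMapΓ f a) H n) hHK)
  obtain ⟨C, hC, ⟨ε⟩⟩ := IH d le_rfl (cokerTower α) h𝓒 h𝓒c h𝓒K hcoker
  -- Step A
  obtain ⟨c, hce, hc⟩ := exists_epi_of_cokerTower_iso f a α hH hC ε
  haveI := hce
  have hαc : α ≫ cmplMap (algebraMapΓ f a) c = 0 := by
    rw [hc, ← Category.assoc, comp_cokerTowerπ, zero_comp]
  have hex : ∀ m, (ShortComplex.mk (α.app ⟨m⟩) ((cmplMap (algebraMapΓ f a) c).app ⟨m⟩)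
      (by rw [← NatTrans.comp_app, hαc, NatTrans.app_zero])).Exact := fun m => by
    have hm : (cmplMap (algebraMapΓ f a) c).app ⟨m⟩ = cokernel.π (α.app ⟨m⟩) ≫ (ε.app ⟨m⟩).hom := by
      rw [hc, NatTrans.comp_app, cokerTowerπ_app, Iso.app_hom]
    refine (ShortComplex.exact_iff_of_iso ?_).mp (exact_of_cokernel_π_comp_iso (α.app ⟨m⟩) (ε.app ⟨m⟩))
    exact ShortComplex.isoMk (Iso.refl _) (Iso.refl _) (Iso.refl _)
      (by simp only [Iso.refl_hom, Category.id_comp, Category.comp_id])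
      (by simp only [Iso.refl_hom, Category.id_comp, Category.comp_id]; exact hm)
  -- Step B
  obtain ⟨αt, hαt, hfac⟩ := exists_lift_levelwise_epi f a h𝓕 α hH hC c hαc hex
  have hkert : ∀ n, IsKilledBy (J ^ d) (kernel (αt.app ⟨n⟩)) := fun n =>
    isKilledBy_kernel_of_fac (αt.app ⟨n⟩) ((cmplMap (algebraMapΓ f a) (kernel.ι c)).app ⟨n⟩)
      (α.app ⟨n⟩) (by rw [← NatTrans.comp_app, hfac]) (hker n)
  -- Step C
  refine exists_coh_iso_of_levelwise_epi f a h𝓕 h𝓕c (Coh.kernel c hH hC) αt hαt hkert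
    fun e he => ?_
  exact IH e he (𝓕 ⋙ idealQuotFunctor (J ^ e)) (h𝓕.comp_idealQuotFunctor (J ^ e))
    (coh_comp_idealQuotFunctor (J ^ e) h𝓕c)
    (fun n => IsKilledBy.of_epi (idealQuotπ (𝓕.obj ⟨n⟩) (J ^ e)) (h𝓕K n))
    (isKilledBy_comp_idealQuotFunctor (J ^ e) 𝓕)

end Assembly

end Literature.AlgebraicGeometry.Morphisms

end
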